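import Literature.MathematicalPhysics.QuantumFieldTheory.Balaban1983to89.B13NodeKnitRecord5C
import Literature.MathematicalPhysics.QuantumFieldTheory.Balaban1983to89.Node00.Record8Inhabited
import Literature.MathematicalPhysics.QuantumFieldTheory.Balaban1983to89.B10LeafUnpinnedRecord5C

/-!
# `Balaban1983to89.B13ResidualLeafProbe` — LOCATED NEGATIVE (vacuity probe) for node N10: at NODE 00's record predicates ₅C ∕ ₈C the B13 group is
# FREE residual data, so the leaf `b13` ([Balaban1988RG2Cluster] Lemmas 1–3) is REFUTABLE there — a junk residual B13 step is admissible — and the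
# K2 stub `S_N10` can be closed over such a predicate ONLY through the displayed slot (B13₅), never from the leaf

statement-level skeleton of published theorems with citation tags; proofs where landed; nothing here is a claim about the Yang–Mills mass gap

Track A, DAG node N10 (KNIT-BY-NAME seat `pub-ymgap-dag-p2` = n10-a, generation 5, 2026-08-26).  HONEST FRAMING: a kernel PROBE in the style of the
cell's Stage-7∕8 regression probes (node00-def STAGE5-SCOPING-g28 (P2) «carriers X.B8∕B10∕B12∕B13 … junk-refutable children until Stages 3′∕4», made a
theorem FOR THE B13 GROUP); count-neutral; it refutes NO printed statement and NO node — it says WHERE the N10 content must come from (a Stage-4(X.B13)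
pin), nothing about [Balaban1988RG2Cluster]; one finite four-torus; nothing continuum ∕ ℝ⁴ ∕ OS ∕ mass-gap ∕ Clay.

WHAT THIS FILE PROVES.
* `exists_stepData_not_lemma1` — for every constants record `c` there is a (junk) `B13.StepData` at which Lemma 1 AS TYPED fails (one localization
  domain, empty analyticity predicate): the typed leaf has content only at Bałaban's objects.
* (private `stage5_admissible_junkB13`) — replacing the residual B13 step data `(θ.res.X P).S13` of an ADMISSIBLE Stage-5 parameter by that junk keeps it
  admissible (`Stage5Params.Admissible` reads `toStage1Params` and `γ` only).
* `not_slot_leafOnly₅` — hence the LEAF-ONLY slot «∀ admissible θ, ∀ P, the B13 triple at `(θ.res.X P).S13`» is FALSE as soon as one admissible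
  Stage-5 parameter exists; the displayed slot (B13₅) of `B13NodeKnitRecord5C` ∕ `BalabanUVNodesN10AtRecord` (in-edges `b9 → b10 → b11 → b12 →` as
  premises, themselves residual) is the only consistent currency before Stage 4(X.B13).
* `exists_record₅C_not_b13` — at the RECORD level: from any ₅C record `(D₀, w₀)` a ₅C record `(D₁, w₁)` with `¬ (leavesP w₁ P).b13` at every run
  (same Stage-1∕2∕3 dictionaries, same `γ`, `L`; only the residual B13 step replaced); `exists_record₈C_not_b13` — the same at ₈C
  (`Stage8Params.Admissible` adds numeric clauses on `ν`, `εbg` only; `residualOfStage8` keeps `X`).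
* §4 UNCONDITIONALLY (both classes are inhabited in the tree: `B10LeafUnpinnedRecord5C.exists_isRecordOfRecord₅C_b10`,
  `Node00.Record8Inhabited.exists_isRecordOfRecord₈C`): `exists_record₅C_not_b13'` ∕ `exists_record₈C_not_b13'` and the negations
  `not_forall_record₅C_b13` ∕ `not_forall_record₇C_b13` ∕ `not_forall_record₈C_b13` : `¬ ∀ D w, IsRecordOfRecord₅C∕₇C∕₈C F N D w → ∀ P, (leavesP w P).b13`
  (₇C through the refinement `Node00.isRecordOfRecord₇C_of_isRecordOfRecord₈C`).
CONSEQUENCE (bookkeeping, for the plan's (W2) «vacuity guards» item and the rev-1 restate): no theorem `∀ D w, IsRecordOfRecord₅C∕₈C F N D w →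
∀ P, (leavesP w P).b13` can exist (§4 proves its negation for ₅C, ₇C, ₈C); `YMDAG.UVSplit.S_N10 Rec` over such a `Rec` holds at most through its in-edge premises; N10's closers stay «from the
slot» until NODE 00 pins `X.S13` (Stage 4).
-/

noncomputable section

namespace Literature.MathematicalPhysics.QuantumFieldTheory.Balaban1983to89.B13ResidualLeafProbe

open Literature.MathematicalPhysics.QuantumFieldTheory.Balaban1983to89
open Literature.MathematicalPhysics.QuantumFieldTheory.Balaban1983to89.T4Continuum (T4Family FiniteEpsData)
open Literature.MathematicalPhysics.QuantumFieldTheory.Balaban1983to89.DagBinding (WorldP leavesP PrintedCarriersR)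
open Literature.MathematicalPhysics.QuantumFieldTheory.Balaban1983to89.Node00

/-! ## §1 A junk B13 step at which Lemma 1 as typed fails -/

/-- **Junk witness**: for every `c : B13.Consts` some `S : B13.StepData` (one localization domain of tree length 0, one configuration, EMPTY
analyticity predicate) violates `B13.Lemma1Printed S c` — its first conjunct `∀ Y, S.Analytic (S.Vp Y) (S.sp1 Y)` fails at the one domain.  The typed
leaf is a statement about WHICH step data it is read at. [cite: Balaban1988RG2Cluster, Lemma 1 p.9 (typed leaf; vacuity probe)] -/
theorem exists_stepData_not_lemma1 (c : B13.Consts) : ∃ S : B13.StepData, ¬ B13.Lemma1Printed S c := by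
  refine ⟨{ Dk := { Dom := Unit, dj := fun _ => 0, dj_nonneg := fun _ => le_rfl },
            Dk1 := { Dom := Unit, dj := fun _ => 0, dj_nonneg := fun _ => le_rfl },
            volk := fun _ => 0, Φ := Unit, Bond := Unit, sp1 := fun _ => Set.univ, sp2 := fun _ => Set.univ,
            Bv := fun _ _ => 0, Vp := fun _ _ => 0, V := fun _ _ => 0, Q := fun _ _ _ _ => 0, Vpp := fun _ _ => 0,
            H := fun _ _ => 0, Ek1 := fun _ _ => 0, Elog := fun _ _ => 0, Analytic := fun _ _ => False,
            GaugeInv := fun _ => True, Repr17 := True, Restr := True }, fun h => ?_⟩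
  exact h.1 ()

/-! ## §2 Junking the residual B13 group of a Stage-5 parameter keeps it admissible -/

variable {F : T4Family} {N : ℕ} [NeZero N]

/-- The Stage-5 parameter `θ` with the residual B13 step data of every run replaced by `S` (constants kept) stays admissible (plumbing). [folklore] -/
private theorem stage5_admissible_junkB13 (θ : Stage5Params F N) (hθ : θ.Admissible) (S : B13.StepData) :
    ({ θ with res := { θ.res with X := fun P => { θ.res.X P with S13 := S } } } : Stage5Params F N).Admissible :=
  hθ

/-- **THE LEAF-ONLY SLOT IS FALSE** once an admissible Stage-5 parameter exists: there is no way to prove the B13 triple at the residual group of EVERY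
admissible `θ` — the residual is free data and the junk step of §1 is admissible.  (The displayed slot (B13₅) carries the residual in-edges as premises;
this probe does not touch it.) [cite: Balaban1988RG2Cluster, Lemmas 1–3 pp.9, 11, 20 (typed leaf; vacuity probe)] -/
theorem not_slot_leafOnly₅ (θ₀ : Stage5Params F N) (h₀ : θ₀.Admissible) :
    ¬ ∀ θ : Stage5Params F N, θ.Admissible → ∀ P : B12.RunParams,
        B13.Lemma1Printed (θ.res.X P).S13 (θ.res.X P).c13 ∧ B13.Lemma2Printed (θ.res.X P).S13 (θ.res.X P).c13 ∧
          B13.Lemma3Printed (θ.res.X P).S13 (θ.res.X P).c13 := by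
  intro h
  obtain ⟨S, hS⟩ := exists_stepData_not_lemma1 ((θ₀.res.X ⟨0, 0, 0⟩).c13)
  exact hS (h _ (stage5_admissible_junkB13 θ₀ h₀ S) ⟨0, 0, 0⟩).1

/-! ## §3 At the record: ₅C and ₈C records with `¬ b13` at every run -/

/-- **A ₅C RECORD AT WHICH THE LEAF `b13` FAILS AT EVERY RUN**, built from any ₅C record by junking the residual B13 step (Stage-1∕2∕3 dictionaries,
`γ`, `L` unchanged; the datum is re-assembled from the modified parameter).  Hence no theorem «`IsRecordOfRecord₅C F N D w → (leavesP w P).b13`».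
[cite: Balaban1988RG2Cluster, Lemmas 1–3 pp.9, 11, 20 (typed leaf at NODE 00's Stage-5 record; vacuity probe)] -/
theorem exists_record₅C_not_b13 {D₀ : FiniteEpsData F (SU N)} {w₀ : WorldP} (h : IsRecordOfRecord₅C F N D₀ w₀) :
    ∃ (D : FiniteEpsData F (SU N)) (w : WorldP), IsRecordOfRecord₅C F N D w ∧ ∀ P : B12.RunParams, ¬ (leavesP w P).b13 := by
  obtain ⟨θ₀, h₀, -, -, hγ, hL, -⟩ := h
  -- one junk step per run, at that run's constants
  let junk : B12.RunParams → B13.StepData := fun P => Classical.choose (exists_stepData_not_lemma1 ((θ₀.res.X P).c13))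
  have hjunk : ∀ P, ¬ B13.Lemma1Printed (junk P) ((θ₀.res.X P).c13) := fun P =>
    Classical.choose_spec (exists_stepData_not_lemma1 ((θ₀.res.X P).c13))
  let θ₁ : Stage5Params F N := { θ₀ with res := { θ₀.res with X := fun P => { θ₀.res.X P with S13 := junk P } } }
  have h₁ : θ₁.Admissible := h₀
  let w₁ : WorldP := { w₀ with C := (datumOfRecord₅ F N θ₁).C, up := fun P => upOfRecord₅C F N θ₁ P }
  refine ⟨datumOfRecord₅ F N θ₁, w₁, ⟨θ₁, h₁, rfl, rfl, hγ, hL, fun P => rfl⟩, fun P hb => ?_⟩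
  have hb' := (B13NodeKnitRecord5C.b13_leaf_iff_res₅C F N θ₁ w₁ P rfl).1 hb
  exact hjunk P hb'.1

/-- **The same at ₈C** (`Stage8Params.Admissible` adds numeric clauses on `ν` and `εbg` only; `residualOfStage8` keeps the carrier bundle `X`): from
any ₈C record a ₈C record at which `b13` fails at every run.  The B13 leaf reads no β-layer ∕ chart, so this is independent of the zero-chart matter
(chair R445 (A)). [cite: Balaban1988RG2Cluster, Lemmas 1–3 pp.9, 11, 20 (typed leaf at NODE 00's Stage-8 record; vacuity probe)] -/
theorem exists_record₈C_not_b13 {D₀ : FiniteEpsData F (SU N)} {w₀ : WorldP} (h : IsRecordOfRecord₈C F N D₀ w₀) :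
    ∃ (D : FiniteEpsData F (SU N)) (w : WorldP), IsRecordOfRecord₈C F N D w ∧ ∀ P : B12.RunParams, ¬ (leavesP w P).b13 := by
  obtain ⟨θ₀, h₀, -, -, hγ, hL, -⟩ := h
  let junk : B12.RunParams → B13.StepData := fun P => Classical.choose (exists_stepData_not_lemma1 ((θ₀.res.X P).c13))
  have hjunk : ∀ P, ¬ B13.Lemma1Printed (junk P) ((θ₀.res.X P).c13) := fun P =>
    Classical.choose_spec (exists_stepData_not_lemma1 ((θ₀.res.X P).c13))
  let θ₁ : Stage8Params F N := { θ₀ with res := { θ₀.res with X := fun P => { θ₀.res.X P with S13 := junk P } } }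
  have h₁ : θ₁.Admissible := h₀
  let w₁ : WorldP :=
    { w₀ with C := (datumOfRecord₅ F N (θ₁.toStage5 F N)).C, up := fun P => upOfRecord₅C F N (θ₁.toStage5 F N) P }
  refine ⟨datumOfRecord₅ F N (θ₁.toStage5 F N), w₁, ⟨θ₁, h₁, rfl, rfl, hγ, hL, fun P => rfl⟩, fun P hb => ?_⟩
  have hb' := (B13NodeKnitRecord5C.b13_leaf_iff_res₅C F N (θ₁.toStage5 F N) w₁ P rfl).1 hb
  exact hjunk P hb'.1

/-! ## §4 Unconditionally: both record classes are INHABITED in the tree, so the leaf-only closers cannot exist -/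

/-- **UNCONDITIONAL ₅C WITNESS**: for every family `F` and `N ≥ 1` a ₅C record at which `b13` fails at every run (the tree's inhabited ₅C record
`B10LeafUnpinnedRecord5C.exists_isRecordOfRecord₅C_b10`, junked in its B13 group). [cite: Balaban1988RG2Cluster, Lemmas 1–3 pp.9, 11, 20 (typed leaf; vacuity probe)] -/
theorem exists_record₅C_not_b13' (F : T4Family) (N : ℕ) [NeZero N] :
    ∃ (D : FiniteEpsData F (SU N)) (w : WorldP), IsRecordOfRecord₅C F N D w ∧ ∀ P : B12.RunParams, ¬ (leavesP w P).b13 := by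
  obtain ⟨D₀, w₀, h₀, -⟩ := B10LeafUnpinnedRecord5C.exists_isRecordOfRecord₅C_b10 F N
  exact exists_record₅C_not_b13 h₀

/-- **NO LEAF-ONLY CLOSER OVER ₅C**: `¬ ∀ D w, IsRecordOfRecord₅C F N D w → ∀ P, (leavesP w P).b13` — so `YMDAG.UVSplit.S_N10` over ₅C is closable only
through the in-edge premises of the displayed slot (B13₅), and a Stage-4(X.B13) pin is what an outright N10 closer waits for.
[cite: Balaban1988RG2Cluster, Lemmas 1–3 pp.9, 11, 20 (typed leaf; vacuity probe)] -/
theorem not_forall_record₅C_b13 (F : T4Family) (N : ℕ) [NeZero N] :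
    ¬ ∀ (D : FiniteEpsData F (SU N)) (w : WorldP), IsRecordOfRecord₅C F N D w → ∀ P : B12.RunParams, (leavesP w P).b13 := by
  intro h
  obtain ⟨D, w, hrec, hnot⟩ := exists_record₅C_not_b13' F N
  exact hnot ⟨0, 0, 0⟩ (h D w hrec ⟨0, 0, 0⟩)

/-- **UNCONDITIONAL ₈C WITNESS** (from `Node00.Record8Inhabited.exists_isRecordOfRecord₈C`, the degenerate zero-chart record — the B13 leaf reads no
chart, so degeneracy is immaterial here). [cite: Balaban1988RG2Cluster, Lemmas 1–3 pp.9, 11, 20 (typed leaf; vacuity probe)] -/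
theorem exists_record₈C_not_b13' (F : T4Family) (N : ℕ) [NeZero N] :
    ∃ (D : FiniteEpsData F (SU N)) (w : WorldP), IsRecordOfRecord₈C F N D w ∧ ∀ P : B12.RunParams, ¬ (leavesP w P).b13 := by
  obtain ⟨D₀, w₀, h₀⟩ := Node00.Record8Inhabited.exists_isRecordOfRecord₈C F N
  exact exists_record₈C_not_b13 h₀

/-- **NO LEAF-ONLY CLOSER OVER ₈C**. [cite: Balaban1988RG2Cluster, Lemmas 1–3 pp.9, 11, 20 (typed leaf; vacuity probe)] -/
theorem not_forall_record₈C_b13 (F : T4Family) (N : ℕ) [NeZero N] :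
    ¬ ∀ (D : FiniteEpsData F (SU N)) (w : WorldP), IsRecordOfRecord₈C F N D w → ∀ P : B12.RunParams, (leavesP w P).b13 := by
  intro h
  obtain ⟨D, w, hrec, hnot⟩ := exists_record₈C_not_b13' F N
  exact hnot ⟨0, 0, 0⟩ (h D w hrec ⟨0, 0, 0⟩)

/-- **₇C follows** (refinement `Node00.isRecordOfRecord₇C_of_isRecordOfRecord₈C` keeps the world, hence the failing leaf). [cite: Balaban1988RG2Cluster, Lemmas 1–3 pp.9, 11, 20 (typed leaf; vacuity probe)] -/
theorem exists_record₇C_not_b13' (F : T4Family) (N : ℕ) [NeZero N] :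
    ∃ (D : FiniteEpsData F (SU N)) (w : WorldP), IsRecordOfRecord₇C F N D w ∧ ∀ P : B12.RunParams, ¬ (leavesP w P).b13 := by
  obtain ⟨D, w, h, hnot⟩ := exists_record₈C_not_b13' F N
  exact ⟨D, w, isRecordOfRecord₇C_of_isRecordOfRecord₈C h, hnot⟩

/-- **NO LEAF-ONLY CLOSER OVER ₇C**. [cite: Balaban1988RG2Cluster, Lemmas 1–3 pp.9, 11, 20 (typed leaf; vacuity probe)] -/
theorem not_forall_record₇C_b13 (F : T4Family) (N : ℕ) [NeZero N] :
    ¬ ∀ (D : FiniteEpsData F (SU N)) (w : WorldP), IsRecordOfRecord₇C F N D w → ∀ P : B12.RunParams, (leavesP w P).b13 := by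
  intro h
  obtain ⟨D, w, hrec, hnot⟩ := exists_record₇C_not_b13' F N
  exact hnot ⟨0, 0, 0⟩ (h D w hrec ⟨0, 0, 0⟩)

end Literature.MathematicalPhysics.QuantumFieldTheory.Balaban1983to89.B13ResidualLeafProbe

end
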